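import Literature.AlgebraicGeometry.Resolution.EquivariantStrongEmbeddedResolution
import HarnessLib

/-!
# Equivariant strong projective resolution in `ℙⁿ_K`: isomorphism over a prescribed smooth open AND lifted group action, for ONE resolution (Kollár 2007, Thm. 3.27 ∕ 3.36 (1)(2)(4))

Topic: `Literature/AlgebraicGeometry/Resolution`. Theorems only (no definition, no named fact; the two `local
notation`s and the `local instance` attribute are those of `ProjectiveStrongResolution.lean`, needed to SPEAK about
Mathlib's `Proj K[x₀,…,xₙ]` and its charts).

J. Kollár, *Lectures on Resolution of Singularities* (2007), Thm. 3.36: «(1) `X_r` is smooth. (2) `Π : X_r → X` is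
an isomorphism over the smooth locus `X^{ns}`. … (4) `𝓑𝓡` commutes with smooth morphisms», §3.4.1 (p. 121): «any
group action on `X` lifts to `X′`». The tree proves (1)(2) over a prescribed open of `ℙⁿ_K`
(`Kollar2007.exists_isResolution_isProjectiveOver_isIso_proj`) and (1)(4) in embedded form
(`exists_equivariant_projective_resolution`) for two different existential witnesses; this file runs both over the
SAME value `𝓑𝓜𝓞_1(ℙⁿ_K, 𝓘_Z, ∅)` of the order-reduction functor of Thm. 3.69:

* `Kollar2007.exists_equivariant_isResolution_isProjectiveOver_isIso_proj` — **for a closed `ι : Z ↪ ℙⁿ_K` (`Z`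
  integral, `char K = 0`), an open `O ⊆ ℙⁿ_K` meeting `Z` inside its regular locus, an action `ρ` of a group `G` on
  `ℙⁿ_K` over `K` and an action `ρZ` of `G` on `Z` with `ι` equivariant: there are a resolution of singularities
  `r : Ỹ → Z` with `Ỹ` projective over `K`, `r` an ISOMORPHISM over `ι⁻¹(O)`, and an action of `G` on `Ỹ` for which
  `r` is EQUIVARIANT** (mechanism: `CentreSeq.exists_equivariant_embeddedTransform_of_isExtensionOfSingle` and
  `exists_isResolution_subschemeι_of_isEmbeddedTransform_isIso`, `EquivariantStrongEmbeddedResolution.lean`; value over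
  `O`: `Kollar2007.value_eq_single_of_regular`; self-inducedness along `ρ g`: 3.34.1,
  `CommutesWithSmoothMorphisms.eq_comap_of_isIso`; restriction of the action to the reduced strict transform:
  `exists_action_restrict_vanishingIdeal_subscheme`);
* `exists_equivariant_isResolution_isProjectiveOver_isIso` — the same in the vocabulary of `Motives.projectiveSpace`.

Route note: brick «B4» of the Kollár-free deck family (P-3′) for route `HodgeConjecture/Q8SymplecticPowers` (crux K1Q,
stmt-HodgeConjecture-24190): the hypothesis `H` of `Q8Family.exists_genericModel_of_surfaceLifting` now lacks only
B3 — a `Q₈`-equivariant closed immersion of the generic model (or of its regular affine chart, with linear action)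
into some `ℙⁿ_K`, the action extending to `ℙⁿ_K` over `K`, the chart inside a prescribed `O`. Nothing here bears on HC.

## References

* [Kollar2007] J. Kollár, Lectures on Resolution of Singularities (2007), Thm. 3.27 (p. 126), Thm. 3.36 (p. 132),
  3.34.1 (p. 131), §3.4.1 (p. 121), Thm. 3.69 (p. 150).
* [Hironaka1964] H. Hironaka, Ann. of Math. 79 (1964), Main Theorem I.
* [BierstoneGrigorievMilmanWlodarczyk2011] E. Bierstone, D. Grigoriev, P. Milman, J. Włodarczyk, Effective Hironaka
  resolution and its complexity, Asian J. Math. 15 (2011), §3.3 and proof of Thm. 4.0.6.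
-/

noncomputable section

open CategoryTheory CategoryTheory.Limits AlgebraicGeometry TopologicalSpace Topology

namespace Literature.AlgebraicGeometry.Resolution

universe u

namespace Kollar2007

open _root_.MvPolynomial HomogeneousLocalization Scheme.IdealSheafData

attribute [local instance] MvPolynomial.gradedAlgebra Motives.ProjBaseChange.algebraBase
  Motives.ProjBaseChange.isScalarTower_localization

variable {K : Type u} [Field K] {n : ℕ}

/-- `ℙⁿ_K = Proj K[x₀, …, xₙ]`, as in `ProjectiveStrongResolution.lean`. -/
local notation "ℙ(" n "; " K ")" => Proj (MvPolynomial.homogeneousSubmodule (Fin (n + 1)) K)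

/-- The structure morphism `ℙⁿ_K → Spec K`, as in `ProjectiveStrongResolution.lean`. -/
local notation "πK(" n "; " K ")" => Motives.ProjBaseChange.projToSpec (Fin (n + 1)) K

variable {Z : Scheme.{u}} (ι : Z ⟶ ℙ(n; K)) [IsClosedImmersion ι] [CharZero K] [IsIntegral Z]
  {G : Type*} [Group G]

/-- **Equivariant strong projective resolution over a prescribed smooth open** (Kollár 2007, Thm. 3.27 ∕ 3.36
(1)(2)(4) with §3.4.1, for ONE resolution). For a closed `ι : Z ↪ ℙⁿ_K` with `Z` integral (`char K = 0`), an open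
`O ⊆ ℙⁿ_K` meeting `Z` inside the regular locus of `Z`, an action `ρ` of a group `G` on `ℙⁿ_K` over `K` and an
action `ρZ` of `G` on `Z` with `ι` equivariant: there are a resolution of singularities `r : Ỹ → Z` (proper,
birational, `Ỹ` regular) with `Ỹ` projective over `K` (structure morphism `r ≫ ι ≫ (ℙⁿ_K → Spec K)`), which is an
ISOMORPHISM over `ι⁻¹(O)`, and an action `ρỸ` of `G` on `Ỹ` for which `r` is EQUIVARIANT.
[cite: Kollar2007, Thm. 3.27 (p. 126), Thm. 3.36 (1)(2)(4) (p. 132), 3.34.1 (p. 131), §3.4.1 (p. 121), Thm. 3.69 (p. 150)]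
[cite: Hironaka1964, Main Theorem I] [cite: BierstoneGrigorievMilmanWlodarczyk2011, §3.3 and proof of Thm. 4.0.6] -/
theorem exists_equivariant_isResolution_isProjectiveOver_isIso_proj (O : Scheme.Opens (ℙ(n; K)))
    (hO : ∃ z : Z, ι z ∈ O) (hreg : ∀ z : Z, ι z ∈ O → IsRegularLocalRing (Z.presheaf.stalk z))
    (ρ : G →* Aut (ℙ(n; K))) (hρK : ∀ g : G, (ρ g).hom ≫ πK(n; K) = πK(n; K))
    (ρZ : G →* Aut Z) (hι : ∀ g : G, (ρZ g).hom ≫ ι = ι ≫ (ρ g).hom) :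
    ∃ (Y : Scheme.{u}) (r : Y ⟶ Z) (ρY : G →* Aut Y), IsResolution r ∧
      Motives.IsProjectiveOver (Over.mk (r ≫ ι ≫ πK(n; K))) ∧ IsIso (r ∣_ ι ⁻¹ᵁ O) ∧
      ∀ g : G, (ρY g).hom ≫ r = r ≫ (ρZ g).hom := by
  classical
  haveI := isProper_projToSpec (K := K) (n := n)
  haveI := isIntegral_proj (K := K) (n := n)
  haveI := isLocallyNoetherian_proj (K := K) (n := n)
  by_cases hZ : Set.range ι = Set.univ
  · -- `Z = ℙⁿ_K`: the identity
    haveI : Surjective ι := ⟨fun y => by rw [← Set.mem_range, hZ]; trivial⟩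
    haveI : IsIso ι := isIso_of_isClosedImmersion_of_surjective ι
    have hZreg : Scheme.IsRegular Z := Scheme.IsRegular.of_isOpenImmersion ι isRegular_proj
    refine ⟨Z, 𝟙 Z, ρZ, ⟨inferInstance, ⟨⊤, by simp, by simp, inferInstance⟩, hZreg⟩, ?_, inferInstance,
      fun g => by simp⟩
    rw [Category.id_comp]
    refine ⟨n, Over.homMk ι ?_, ‹IsClosedImmersion ι›⟩
    change ι ≫ (Motives.projectiveSpace n K).hom = ι ≫ πK(n; K)
    rw [Motives.projectiveSpace_hom_eq_projToSpec]
  · -- the functor `𝓑𝓜𝓞_1` on the triple `(ℙⁿ_K, 𝓘_Z, ∅)`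
    set T : Triple K n := projTriple ι hZ with hTdef
    obtain ⟨B, hB, hBs, -, -⟩ :=
      (Kollar2007Thm3_103_holds.orderReduction Kollar2007Thm3_107_holds n).2 1 le_rfl
    -- the generic point `ξ` of `Z ⊆ ℙⁿ` lies in `O`
    set ξ : ℙ(n; K) := ι (genericPoint Z) with hξdef
    have hgen : IsGenericPoint ξ (Set.range ι) := by
      have := (genericPoint_spec Z).image ι.continuous
      rwa [Set.image_univ, ι.isClosedEmbedding.isClosed_range.closure_eq] at this
    have hYξ : Set.range ι = closure {ξ} := hgen.symm
    have hξO : ξ ∈ O := by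
      obtain ⟨z, hz⟩ := hO
      exact (hgen.mem_open_set_iff O.isOpen).mpr ⟨ι z, Set.mem_range_self z, hz⟩
    -- the value on `O` and the extension property of the restriction to `O` (3.34.1)
    have hmeets : ∃ o : O, O.ι o ∈ Set.range ι := ⟨⟨ξ, hξO⟩, genericPoint Z, rfl⟩
    have hval : B (T.comapLocalIso O.ι) = CentreSeq.single (ι.ker.comap O.ι) :=
      value_eq_single_of_regular ι hZ (fun T => hB T) hBs O hmeets hreg
    have hcomm := (hBs T (T.comapLocalIso O.ι) O.ι trivial trivial
      (T.isPullbackAlong_comapLocalIso O.ι)).2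
    rw [hval] at hcomm
    have hext : ((B T).restrict O.ι).IsExtensionOfSingle (ι.ker.comap O.ι) := by
      rw [CentreSeq.restrict_eq_comap, ← CentreSeq.isExtensionOf_single_iff, hcomm]
      exact CentreSeq.isExtensionOf_prune _
    -- `𝓑(T) = (ρ g)^* 𝓑(T)` (3.34.1 along the automorphism `ρ g` of the triple) and stability of `ι(Z)`
    have hT : TripleClass.all n T := trivial
    have hρs : ∀ g : G, B T = (B T).comap (ρ g).hom := fun g =>
      hBs.eq_comap_of_isIso T hT (ρ g).hom
        ⟨hρK g, (ker_comap_eq_of_equivariant ι ρ ρZ hι g).symm, rfl⟩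
    have hρY : ∀ g : G, (ρ g).hom ⁻¹' closure {ξ} = closure {ξ} := by
      intro g; rw [← hYξ]; exact preimage_range_eq_of_equivariant ι ρ ρZ hι g
    -- the steps preceding the swallowing blow-up have centres off `O`
    have hξT : ξ ∉ (O : Set (ℙ(n; K)))ᶜ := fun h => h hξO
    have hU₀T : (O : Set (ℙ(n; K)))ᶜ ⊆ (O : Set (ℙ(n; K)))ᶜ := subset_rfl
    have hJ : ∃ u ∈ ((ι.ker).comap O.ι).support, (𝟙 (ℙ(n; K))) (O.ι u) = ξ := by
      refine ⟨⟨ξ, hξO⟩, ?_, rfl⟩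
      rw [← SetLike.mem_coe, coe_support_ker_comap ι]
      exact ⟨genericPoint Z, rfl⟩
    have hV : ((T.marked 1).ideal.support : Set (ℙ(n; K))) ⊆ (𝟙 (ℙ(n; K))) ⁻¹' closure {ξ} := by
      change ((ι.ker).support : Set (ℙ(n; K))) ⊆ (𝟙 (ℙ(n; K))) ⁻¹' closure {ξ}
      rw [coe_support_ker_of_isClosedImmersion ι, hYξ]
      exact fun x hx => hx
    obtain ⟨X', σ, Y', ρ'', hET, hreg', hρ''σ, hρ''Y⟩ :=
      CentreSeq.exists_equivariant_embeddedTransform_of_isExtensionOfSingle (A := ℙ(n; K)) hξT hU₀T ρ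
        (B T) (𝟙 _) (closure {ξ}) IsEmbeddedTransform.refl O.ι
        (by rw [Scheme.Opens.range_ι]; exact fun x hx => hx)
        ((ι.ker).comap O.ι) hJ (T.marked 1) rfl hV (hB T).1.1 hext ρ (fun g => by simp) hρY hρs
    -- extract the resolution, remembering the isomorphism over `O`, with the action
    have hPproj : Motives.IsProjectiveOver (Over.mk (πK(n; K))) := by
      have h := isProjectiveOver_mk_hom
        (Motives.isSmoothProjective_projectiveSpace_holds K n).isProjectiveOver
      rwa [Motives.projectiveSpace_hom_eq_projToSpec] at h
    have hX' : Motives.IsProjectiveOver (Over.mk (σ ≫ πK(n; K))) := hET.isProjectiveOver _ hPproj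
    rw [← hYξ] at hET
    obtain ⟨r, hresol, hr, V, hOV, hisoV⟩ :=
      exists_isResolution_subschemeι_of_isEmbeddedTransform_isIso ι hξT hET hreg'
    -- the action restricts to the reduced strict transform
    have hZst : ∀ g : G, (ρ'' g).hom ⁻¹' ((⟨closure Y', isClosed_closure⟩ : Closeds X') : Set X') =
        (⟨closure Y', isClosed_closure⟩ : Closeds X') := by
      intro g
      change (ρ'' g).hom.homeomorph ⁻¹' closure Y' = closure Y'
      rw [(ρ'' g).hom.homeomorph.preimage_closure]
      exact congrArg closure (hρ''Y g)
    obtain ⟨ρY, hρY'⟩ :=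
      exists_action_restrict_vanishingIdeal_subscheme ρ'' (⟨closure Y', isClosed_closure⟩ : Closeds X') hZst
    refine ⟨_, r, ρY, hresol, ?_, ?_, fun g => ?_⟩
    · -- `Ỹ ↪ X' → Spec K` with `X'` projective over `K`
      obtain ⟨N, e, he⟩ := hX'
      have hw : r ≫ ι ≫ πK(n; K) = (vanishingIdeal (⟨closure Y', isClosed_closure⟩ : Closeds X')).subschemeι ≫
          σ ≫ πK(n; K) := by rw [← Category.assoc, hr, Category.assoc]
      refine ⟨N, Over.homMk ((vanishingIdeal (⟨closure Y', isClosed_closure⟩ : Closeds X')).subschemeι ≫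
        e.left) ?_, ?_⟩
      · change (_ ≫ e.left) ≫ (Motives.projectiveSpace N K).hom = r ≫ ι ≫ πK(n; K)
        rw [Category.assoc, hw]
        congr 1
        exact Over.w e
      · change IsClosedImmersion (_ ≫ e.left)
        exact MorphismProperty.comp_mem @IsClosedImmersion
          (vanishingIdeal (⟨closure Y', isClosed_closure⟩ : Closeds X')).subschemeι e.left inferInstance he
    · -- isomorphism over `ι⁻¹(O) ⊆ ι⁻¹(V)`
      rw [compl_compl] at hOV
      haveI := hisoV
      exact Morphisms.isIso_morphismRestrict_of_le r (show ι ⁻¹ᵁ O ≤ ι ⁻¹ᵁ V from fun z hz => hOV hz)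
    · -- equivariance of `r` (cancel the monomorphism `ι`)
      rw [← cancel_mono ι]
      simp only [Category.assoc]
      rw [hι g, hr, reassoc_of% (hρY' g), hρ''σ g, reassoc_of% hr]

end Kollar2007

/-- **The same statement in the vocabulary of `Motives.projectiveSpace`** (for a closed immersion into the tree's
`ℙⁿ_K = (Motives.projectiveSpace n K).left`, its structure morphism, and an action on it over `K`).
[cite: Kollar2007, Thm. 3.27 (p. 126) and Thm. 3.36 (1)(2)(4) (p. 132)] [cite: Hironaka1964, Main Theorem I] -/
theorem exists_equivariant_isResolution_isProjectiveOver_isIso {K : Type u} [Field K] [CharZero K] {n : ℕ}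
    {Z : Scheme.{u}} [IsIntegral Z] (ι : Z ⟶ (Motives.projectiveSpace n K).left) [hι : IsClosedImmersion ι]
    (O : (Motives.projectiveSpace n K).left.Opens) (hO : ∃ z : Z, ι z ∈ O)
    (hreg : ∀ z : Z, ι z ∈ O → IsRegularLocalRing (Z.presheaf.stalk z)) {G : Type*} [Group G]
    (ρ : G →* Aut (Motives.projectiveSpace n K).left)
    (hρK : ∀ g : G, (ρ g).hom ≫ (Motives.projectiveSpace n K).hom = (Motives.projectiveSpace n K).hom)
    (ρZ : G →* Aut Z) (hιρ : ∀ g : G, (ρZ g).hom ≫ ι = ι ≫ (ρ g).hom) :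
    ∃ (Y : Scheme.{u}) (r : Y ⟶ Z) (ρY : G →* Aut Y), IsResolution r ∧
      Motives.IsProjectiveOver (Over.mk (r ≫ ι ≫ (Motives.projectiveSpace n K).hom)) ∧
      IsIso (r ∣_ ι ⁻¹ᵁ O) ∧ ∀ g : G, (ρY g).hom ≫ r = r ≫ (ρZ g).hom := by
  rw [Motives.projectiveSpace_hom_eq_projToSpec] at hρK ⊢
  exact @Kollar2007.exists_equivariant_isResolution_isProjectiveOver_isIso_proj K _ n Z ι hι _ _ G _ O hO hreg
    ρ hρK ρZ hιρ

end Literature.AlgebraicGeometry.Resolution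

end
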